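import Mathlib
import Literature.Claims.NS.Tyhtila2007
import HarnessLib

/-!
# Solo salvage for claim C50 `Tyhtila2007` (cell `ns-claims`, D-0090): Step 1 (the §3 shear wave) is TRUE

Claim: J. I. Tyhtila, arXiv:0707.1976v5 (2007), «Analytical solution for 3-dimensional, incompressible
Navier-Stokes equations (with a suitable external force field)» (row C50, SOL type; skeleton p482915,
typist-8 g2; refuter-8; salvage lane salvage-p4 g2 per RULING v1.29i). The printed §4 construction with a
chosen force is the adjudication target (`Step_4_chooseBackwards`); independently of it, §3 (7)–(29) pp.2–4
prints the UNFORCED «trivial solution» `u = (w,w,w)`, `w = e^{−ν(α²+β²+γ²)t} cos(αx+βy+γz)` with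
`α + β + γ = 0`, `p = c` — typed as `Literature.Claims.NS.Tyhtila2007.Step_1_shearWave`. This file proves it
in the kernel:

* `laplacian_comp_inner` — the Laplacian of a plane profile `x ↦ g⟪k,x⟫` on `ℝ³` is
  `‖k‖²·g″⟪k,x⟫` (Mathlib's `Laplacian` via an orthonormal basis + the chain rule with the linear map
  `innerSL ℝ k`);
* `isNavierStokesSolution_planeShearWave` — for ANY `k ⊥ d` in `ℝ³`, the transversal plane shear wave (written out explicitly; no definition is introduced)
  `u(t,x) = e^{−ν‖k‖²t} cos⟪k,x⟫ · d` with constant pressure is an `IsNavierStokesSolution ν 0` (the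
  convective term vanishes because `⟪k, u⟫ = 0`; `div u = ⟪k,d⟫·(…) = 0`; `∂ₜu = νΔu`), and
  `isSmoothOnHalfSpace_planeShearWave`;
* `step1_shearWave_holds : Step_1_shearWave` — the paper's instance `k = (α,β,γ)`, `d = (1,1,1)`,
  `⟪k,d⟫ = α+β+γ = 0`.

Nothing here bears on the locator (§4, forced, complex-valued); this is the salvage of the one genuine
Navier–Stokes solution the text contains (a classical parallel shear flow / heat wave).

WHAT THIS IS NOT: not a claim about NS regularity or blow-up; not a claim about any author beyond the typed locator.
-/

set_option linter.dupNamespace false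

noncomputable section

namespace Summit.NavierStokesRegularity.NavierStokesRegularity.Theorems.Tyhtila2007

open Set Real Filter Topology InnerProductSpace
open scoped Laplacian RealInnerProductSpace ContDiff
open Literature.Analysis.FluidPDE Literature.Claims.NS.Tyhtila2007

/-! ## The Laplacian of a plane profile -/

/-- **`Δ(g∘⟪k,·⟫)(x) = ‖k‖² g″(⟪k,x⟫)`** on `ℝ³`: second derivative along an orthonormal basis of a
function of one linear coordinate (chain rule with the continuous linear map `innerSL ℝ k`, then
`Σᵢ ⟪k,eᵢ⟫² = ‖k‖²`). [cite: Tyhtila2007, (11) p.2 (`∇²u` of the plane wave)] -/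
theorem laplacian_comp_inner {g : ℝ → ℝ} (hg : ContDiff ℝ 2 g) (k x : R3) :
    (Δ (fun y : R3 => g ⟪k, y⟫_ℝ)) x = ‖k‖ ^ 2 * iteratedDeriv 2 g ⟪k, x⟫_ℝ := by
  have hφ : (fun y : R3 => g ⟪k, y⟫_ℝ) = g ∘ (innerSL ℝ k : R3 →L[ℝ] ℝ) := by
    funext y; simp
  rw [hφ, laplacian_eq_iteratedFDeriv_orthonormalBasis _ (EuclideanSpace.basisFun (Fin 3) ℝ)]
  have hterm : ∀ v : R3, iteratedFDeriv ℝ 2 (g ∘ (innerSL ℝ k : R3 →L[ℝ] ℝ)) x ![v, v] =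
      ⟪k, v⟫_ℝ ^ 2 * iteratedDeriv 2 g ⟪k, x⟫_ℝ := by
    intro v
    rw [ContinuousLinearMap.iteratedFDeriv_comp_right _ hg x (by norm_num),
      ContinuousMultilinearMap.compContinuousLinearMap_apply, iteratedFDeriv_apply_eq_iteratedDeriv_mul_prod]
    simp [Fin.prod_univ_two, innerSL_apply_apply, sq, smul_eq_mul]
  simp only [hterm]
  rw [← Finset.sum_mul]
  congr 1
  rw [EuclideanSpace.real_norm_sq_eq]
  refine Finset.sum_congr rfl fun i _ => ?_
  rw [EuclideanSpace.basisFun_apply, EuclideanSpace.inner_single_right]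
  simp

/-! ## Transversal plane shear waves are exact Navier–Stokes solutions -/

/-- The scalar amplitude `y ↦ e^{−ν‖k‖²t} cos⟪k,y⟫` has derivative
`h ↦ e^{−ν‖k‖²t}·(−sin⟪k,x⟫)·⟪k,h⟫`. [folklore] -/
private theorem hasFDerivAt_amplitude (ν : ℝ) (k : R3) (t : ℝ) (x : R3) :
    HasFDerivAt (fun y : R3 => Real.exp (-(ν * ‖k‖ ^ 2) * t) * Real.cos ⟪k, y⟫_ℝ)
      (Real.exp (-(ν * ‖k‖ ^ 2) * t) • (-Real.sin ⟪k, x⟫_ℝ) • (innerSL ℝ k : R3 →L[ℝ] ℝ)) x := by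
  have hθ : HasFDerivAt (fun y : R3 => ⟪k, y⟫_ℝ) (innerSL ℝ k : R3 →L[ℝ] ℝ) x :=
    (innerSL ℝ k : R3 →L[ℝ] ℝ).hasFDerivAt
  exact (hθ.cos).const_mul _

/-- The velocity has derivative `h ↦ (e^{−ν‖k‖²t}(−sin⟪k,x⟫)⟪k,h⟫) · d`. [folklore] -/
private theorem hasFDerivAt_planeShearWave (ν : ℝ) (k d : R3) (t : ℝ) (x : R3) :
    HasFDerivAt (fun y : R3 => (Real.exp (-(ν * ‖k‖ ^ 2) * t) * Real.cos ⟪k, y⟫_ℝ) • d)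
      ((Real.exp (-(ν * ‖k‖ ^ 2) * t) • (-Real.sin ⟪k, x⟫_ℝ) • (innerSL ℝ k : R3 →L[ℝ] ℝ)).smulRight d) x :=
  (hasFDerivAt_amplitude ν k t x).smul_const d

/-- The plane shear wave is smooth on `ℝ³ × [0,∞)` (indeed on all of `ℝ × ℝ³`). [cite: Tyhtila2007, §3 p.4] -/
theorem isSmoothOnHalfSpace_planeShearWave (ν : ℝ) (k d : R3) :
    IsSmoothOnHalfSpace (fun (t : ℝ) (y : R3) => (Real.exp (-(ν * ‖k‖ ^ 2) * t) * Real.cos ⟪k, y⟫_ℝ) • d) := by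
  have h : ContDiff ℝ ∞ (Function.uncurry (fun (t : ℝ) (y : R3) => (Real.exp (-(ν * ‖k‖ ^ 2) * t) * Real.cos ⟪k, y⟫_ℝ) • d)) := by
    have h1 : ContDiff ℝ ∞ fun q : ℝ × R3 => -(ν * ‖k‖ ^ 2) * q.1 := contDiff_const.mul contDiff_fst
    have h2 : ContDiff ℝ ∞ fun q : ℝ × R3 => ⟪k, q.2⟫_ℝ :=
      ((innerSL ℝ k : R3 →L[ℝ] ℝ).contDiff).comp contDiff_snd
    exact (h1.exp.mul h2.cos).smul contDiff_const
  exact h.contDiffOn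

/-- **Transversal plane shear waves solve Navier–Stokes.** For every viscosity `ν`, every wave vector
`k` and direction `d` with `⟪k,d⟫ = 0`, and every constant `c`, the field
`u(t,x) = e^{−ν‖k‖²t} cos⟪k,x⟫ · d` with pressure `p ≡ c` satisfies the unforced system (1)–(3):
`(u·∇)u = 0` (the gradient of `u` is along `k ⊥ u`), `div u = 0`, `∂ₜu = −ν‖k‖²u = νΔu`.
A classical parallel shear flow; the paper's §3 solution is the case `k = (α,β,γ)`, `d = (1,1,1)`.
[cite: Tyhtila2007, (27)–(29) p.4] -/
theorem isNavierStokesSolution_planeShearWave (ν : ℝ) {k d : R3} (hkd : ⟪k, d⟫_ℝ = 0) (c : ℝ) :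
    IsNavierStokesSolution ν 0 (fun y : R3 => (Real.exp (-(ν * ‖k‖ ^ 2) * 0) * Real.cos ⟪k, y⟫_ℝ) • d)
      (fun (t : ℝ) (y : R3) => (Real.exp (-(ν * ‖k‖ ^ 2) * t) * Real.cos ⟪k, y⟫_ℝ) • d) (fun _ _ => c) := by
  set U : ℝ → R3 → R3 := (fun (t : ℝ) (y : R3) => (Real.exp (-(ν * ‖k‖ ^ 2) * t) * Real.cos ⟪k, y⟫_ℝ) • d) with hU
  refine ⟨?_, ?_, rfl⟩
  · -- momentum
    intro t ht x
    set K : ℝ := ‖k‖ ^ 2 with hK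
    set θ : ℝ := ⟪k, x⟫_ℝ with hθ
    set A : ℝ := Real.exp (-(ν * K) * t) with hA
    -- time derivative
    have hdt : HasDerivAt (fun s => U s x) ((A * (-(ν * K)) * Real.cos θ) • d) t := by
      have h1 : HasDerivAt (fun s : ℝ => -(ν * K) * s) (-(ν * K)) t := by
        simpa using (hasDerivAt_id t).const_mul (-(ν * K))
      exact ((h1.exp).mul_const (Real.cos θ)).smul_const d
    have hdtw : derivWithin (fun s => U s x) (Ici 0) t = ((A * (-(ν * K)) * Real.cos θ) • d) :=
      hdt.hasDerivWithinAt.derivWithin (uniqueDiffOn_Ici 0 t ht)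
    -- convective term vanishes
    have hconv : fderiv ℝ (U t) x (U t x) = 0 := by
      rw [(hasFDerivAt_planeShearWave ν k d t x).fderiv]
      simp [hU, ContinuousLinearMap.smulRight_apply, innerSL_apply_apply, hkd]
    -- Laplacian
    have hlap : (Δ (U t)) x = (A * (K * -Real.cos θ)) • d := by
      have hsplit : U t =
          (ContinuousLinearMap.toSpanSingleton ℝ d : ℝ →L[ℝ] R3) ∘
            (fun y : R3 => A * Real.cos ⟪k, y⟫_ℝ) := by
        funext y; simp [hU, ContinuousLinearMap.toSpanSingleton_apply, hA, hK]
      have hc2 : ContDiffAt ℝ 2 (fun y : R3 => A * Real.cos ⟪k, y⟫_ℝ) x :=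
        (contDiff_const.mul (((innerSL ℝ k : R3 →L[ℝ] ℝ).contDiff).cos)).contDiffAt
      rw [hsplit, hc2.laplacian_CLM_comp_left]
      simp only [Function.comp_apply, ContinuousLinearMap.toSpanSingleton_apply]
      congr 1
      have hsm : (fun y : R3 => A * Real.cos ⟪k, y⟫_ℝ) = A • fun y : R3 => Real.cos ⟪k, y⟫_ℝ := by
        funext y; simp [smul_eq_mul]
      have hcos2 : ContDiffAt ℝ 2 (fun y : R3 => Real.cos ⟪k, y⟫_ℝ) x :=
        (((innerSL ℝ k : R3 →L[ℝ] ℝ).contDiff).cos).contDiffAt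
      rw [hsm, laplacian_smul A hcos2, laplacian_comp_inner Real.contDiff_cos k x, smul_eq_mul]
      have h2 : iteratedDeriv 2 Real.cos = -Real.cos := by
        have h21 : iteratedDeriv (2 * 1) Real.cos = (-1) ^ 1 * Real.cos := Real.iteratedDeriv_even_cos 1
        rw [mul_one, pow_one, neg_one_mul] at h21
        exact h21
      rw [h2]
      simp [hθ, hK]
    -- assemble
    rw [hdtw, hconv, hlap, gradient_fun_const]
    simp only [add_zero, sub_zero, Pi.zero_apply, smul_smul]
    congr 1
    ring
  · -- divergence free
    intro t _ x
    unfold NSWave0.divergence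
    show LinearMap.trace ℝ R3 (fderiv ℝ (fun y : R3 => (Real.exp (-(ν * ‖k‖ ^ 2) * t) * Real.cos ⟪k, y⟫_ℝ) • d) x : R3 →ₗ[ℝ] R3) = 0
    rw [(hasFDerivAt_planeShearWave ν k d t x).fderiv]
    set ψ : R3 →L[ℝ] ℝ :=
      Real.exp (-(ν * ‖k‖ ^ 2) * t) • (-Real.sin ⟪k, x⟫_ℝ) • (innerSL ℝ k : R3 →L[ℝ] ℝ) with hψ
    have hcoe : ((ψ.smulRight d : R3 →L[ℝ] R3) : R3 →ₗ[ℝ] R3) = (ψ : R3 →ₗ[ℝ] ℝ).smulRight d := rfl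
    rw [hcoe, LinearMap.trace_smulRight]
    simp [hψ, hkd]

/-! ## The paper's Step 1 -/

/-- The paper's shear wave (28) is the plane shear wave with `k = (α,β,γ)`, `d = (1,1,1)`. [cite: Tyhtila2007, (28) p.4] -/
theorem shearWave_eq (ν α β γ : ℝ) :
    shearWave ν α β γ = fun (t : ℝ) (y : R3) =>
      (Real.exp (-(ν * ‖(!₂[α, β, γ] : R3)‖ ^ 2) * t) * Real.cos ⟪(!₂[α, β, γ] : R3), y⟫_ℝ) •
        (EuclideanSpace.single 0 1 + EuclideanSpace.single 1 1 + EuclideanSpace.single 2 1 : R3) := by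
  funext t x
  have hin : ⟪(!₂[α, β, γ] : R3), x⟫_ℝ = α * x 0 + β * x 1 + γ * x 2 := by
    simp [PiLp.inner_apply, Fin.sum_univ_three, mul_comm]
  have hnorm : ‖(!₂[α, β, γ] : R3)‖ ^ 2 = α ^ 2 + β ^ 2 + γ ^ 2 := by
    rw [EuclideanSpace.real_norm_sq_eq]
    simp [Fin.sum_univ_three]
  simp only [shearWave, hin, hnorm]

/-- **Step 1 of C50 is TRUE**: for `α + β + γ = 0` and any constant `c`, the §3 «trivial solution»
`u = (w,w,w)`, `w = e^{−ν(α²+β²+γ²)t}cos(αx+βy+γz)`, `p = c` is a smooth solution of the unforced system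
(1)–(2) on `ℝ³ × [0,∞)` with datum `u(·,0)`. [cite: Tyhtila2007, (27)–(29) p.4] -/
theorem step1_shearWave_holds : Literature.Claims.NS.Tyhtila2007.Step_1_shearWave := by
  intro ν α β γ c _hν hsum
  have hkd : ⟪(!₂[α, β, γ] : R3),
      (EuclideanSpace.single 0 1 + EuclideanSpace.single 1 1 + EuclideanSpace.single 2 1 : R3)⟫_ℝ = 0 := by
    simp [PiLp.inner_apply, inner_add_right]
    linarith
  rw [shearWave_eq]
  exact ⟨isSmoothOnHalfSpace_planeShearWave _ _ _, isNavierStokesSolution_planeShearWave ν hkd c⟩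

end Summit.NavierStokesRegularity.NavierStokesRegularity.Theorems.Tyhtila2007
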